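import Literature.NumberTheory.EllipticCurves.AnalyticRankBCDTProofs
import Literature.NumberTheory.Automorphic.BCDTTheoremB
import HarnessLib

/-!
# `L(E, s)` is entire: the trust base of `WeierstrassCurve.hasEntireLFunction_rat`, one printed layer further

A `…Proofs` sibling (theorems only: no definitions, no named facts, no instances) of
`Literature.NumberTheory.EllipticCurves.AnalyticRank` and of `AnalyticRankBCDTProofs`, written by
the tenured seat of the named fact `WeierstrassCurve.hasEntireLFunction_rat` ("for every elliptic
curve `E / ℚ`, `L(E, s)` is the restriction to `re s > 3/2` of an entire function";
Breuil–Conrad–Diamond–Taylor 2001, Thm. A, with Hecke).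

`AnalyticRankBCDTProofs` records the printed proof line
"Thm. B (= Thm. 2.2.1) + [CDT] Thm. 7.2.4 ⇒ Thm. 2.2.2 = Thm. A ⇒ (Carayol, Hecke) `L(E, s)` entire"
as `WeierstrassCurve.hasEntireLFunction_rat_of_theoremB_of_CDT`.  Since then the tree proves the
case analysis of BCDT §2.2 (JAMS 14 (2001), pp. 861–862) *inside* Theorem 2.2.1
(`Literature.NumberTheory.Automorphic.BCDTTheoremB`): the tame case from [CDT] Thm. 7.2.1, the
reduction "Theorem B (p. 843) ⟺ Thm. 2.2.1", and the assembly
`theoremB_of_wild_of_auxiliaryCurve_of_CDT721`, whose remaining inputs are exactly the named facts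

* `exists_isTorsionGaloisRep_and_isModular_of_not_isTamelyRamifiedAbove` — the case of Thm. 2.2.1
  wild above `3` (BCDT §§1, 3–9 with Thms. 1.4.1–1.4.2 and Langlands–Tunnell);
* `exists_isTorsionGaloisRep_five_and_surjective_three` — the auxiliary curve of the `3`–`5`
  switch ([SBT] §1 with Hilbert irreducibility);
* `CDT_theorem_7_2_1` (Conrad–Diamond–Taylor 1999, Thm. 7.2.1), or the stronger `CDT_theorem_7_1_2`;
* Ogg–Saito in Galois form at `ℓ = 5`
  (`WeierstrassCurve.artinConductorExponent_tate_eq_conductorExponent_of_isElliptic · 5`).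

This file only composes, so that the trust base of `hasEntireLFunction_rat` inside the tree at the
finest layer statable today is recorded by single searchable theorems:

* `WeierstrassCurve.hasEntireLFunction_rat_of_wild_of_auxiliaryCurve_of_CDT721_724` — the inputs
  as printed in BCDT §2.2: {wild case of Thm. 2.2.1, auxiliary curve, [CDT] Thm. 7.2.1, Ogg–Saito
  at `5`} for Thm. 2.2.1, then [CDT] Thm. 7.2.4 for Thm. 2.2.2;
* `WeierstrassCurve.hasEntireLFunction_rat_of_wild_of_auxiliaryCurve_of_CDT712_722` — with the
  two [CDT] §7.2 corollaries replaced by their printed inputs [CDT] Thms. 7.1.2 and 7.2.2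
  (`CDTModularityProofs`, `CDT_theorem_7_2_1_of_7_1_2`): trust base
  {wild case of Thm. 2.2.1, auxiliary curve, CDT Thm. 7.1.2, CDT Thm. 7.2.2, Ogg–Saito at `5`}.

No statement of `AnalyticRank` is touched; `hasEntireLFunction_rat` itself stays a named fact
until those leaves are discharged (each is a theory of its own: modularity lifting for potentially
Barsotti–Tate `3`-adic representations, `R = T` at `3` and `5`, Néron models), at which point
`hasEntireLFunction_rat_holds` is a one-line application of either theorem below.

## References
* [cite: BCDTJAMS2001, Theorem A (p. 843), Theorem 2.2.1 and Theorem 2.2.2 (pp. 861–862)] —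
  C. Breuil, B. Conrad, F. Diamond, R. Taylor, *On the modularity of elliptic curves over `ℚ`:
  wild 3-adic exercises*, J. Amer. Math. Soc. 14 (2001), 843–939.
* [cite: doi:10.1090/S0894-0347-99-00287-8, Theorems 7.1.2, 7.2.1, 7.2.2, 7.2.4 (p. 556)] —
  B. Conrad, F. Diamond, R. Taylor, *Modularity of certain potentially Barsotti–Tate Galois
  representations*, J. Amer. Math. Soc. 12 (1999), 521–567.
* F. Diamond, J. Shurman, *A First Course in Modular Forms*, GTM 228, Thm. 8.8.3 and Thm. 5.10.2.
-/

noncomputable section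

namespace WeierstrassCurve

open Literature.NumberTheory.Automorphic.BCDT

/-- **`L(E, s)` is entire for every `E / ℚ`, from the printed inputs of BCDT §2.2.** Theorem 2.2.1
(= Theorem B) from its wild case, the auxiliary curve of the `3`–`5` switch, [CDT] Thm. 7.2.1 and
Ogg–Saito at `ℓ = 5` (`theoremB_of_wild_of_auxiliaryCurve_of_CDT721`, the tame case and the case
distinction being proved in `BCDTTheoremB`); then Theorem 2.2.2 = Theorem A from Theorem 2.2.1 and
[CDT] Thm. 7.2.4, and the entire continuation by Hecke
(`hasEntireLFunction_rat_of_theoremB_of_CDT`). Trust base of `hasEntireLFunction_rat` after this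
theorem: {wild case of BCDT Thm. 2.2.1, [SBT] auxiliary curve, CDT Thm. 7.2.1, CDT Thm. 7.2.4,
Ogg–Saito for `V₅ E`}. [cite: BCDTJAMS2001, Theorems 2.2.1, 2.2.2 and Theorem A] -/
theorem hasEntireLFunction_rat_of_wild_of_auxiliaryCurve_of_CDT721_724
    (hW : exists_isTorsionGaloisRep_and_isModular_of_not_isTamelyRamifiedAbove)
    (hE : exists_isTorsionGaloisRep_five_and_surjective_three) (h721 : CDT_theorem_7_2_1)
    (h724 : CDT_theorem_7_2_4)
    (hOgg : ∀ W : WeierstrassCurve ℚ,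
      W.artinConductorExponent_tate_eq_conductorExponent_of_isElliptic 5) :
    hasEntireLFunction_rat :=
  hasEntireLFunction_rat_of_theoremB_of_CDT
    (theoremB_of_wild_of_auxiliaryCurve_of_CDT721 hW hE h721 hOgg) h724

/-- **`L(E, s)` is entire for every `E / ℚ`, from the wild case of BCDT Thm. 2.2.1, the auxiliary
curve, CDT Thms. 7.1.2 and 7.2.2, and Ogg–Saito for `V₅ E`.** The same deduction with the two
[CDT] §7.2 corollaries replaced by their printed inputs: Thm. 7.2.1 by the stronger Thm. 7.1.2
(`CDT_theorem_7_2_1_of_7_1_2`) and Thm. 7.2.4 by Thms. 7.1.2, 7.2.2 and Ogg–Saito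
(`CDTModularityProofs`), via `exists_isNewformOf_of_wild_of_auxiliaryCurve_of_CDT712_722`
(the Modularity Theorem `exists_isNewformOf` from these five inputs, `BCDTTheoremB`) and
`hasEntireLFunction_rat_of_exists_isNewformOf` (Hecke; Diamond–Shurman Thm. 8.8.3 with
Thm. 5.10.2). This is the finest trust base of `hasEntireLFunction_rat` statable in the tree:
{wild case of BCDT Thm. 2.2.1, [SBT] auxiliary curve, CDT Thm. 7.1.2, CDT Thm. 7.2.2,
Ogg–Saito for `V₅ E`}. [cite: BCDTJAMS2001, Theorems 2.2.1, 2.2.2 and Theorem A] -/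
theorem hasEntireLFunction_rat_of_wild_of_auxiliaryCurve_of_CDT712_722
    (hW : exists_isTorsionGaloisRep_and_isModular_of_not_isTamelyRamifiedAbove)
    (hE : exists_isTorsionGaloisRep_five_and_surjective_three) (h712 : CDT_theorem_7_1_2)
    (h722 : CDT_theorem_7_2_2)
    (hOgg : ∀ W : WeierstrassCurve ℚ,
      W.artinConductorExponent_tate_eq_conductorExponent_of_isElliptic 5) :
    hasEntireLFunction_rat :=
  hasEntireLFunction_rat_of_exists_isNewformOf
    (exists_isNewformOf_of_wild_of_auxiliaryCurve_of_CDT712_722 hW hE h712 h722 hOgg)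

/-- **Per curve.** For a single elliptic `W / ℚ`, `W.HasEntireLFunction` from the five finest
leaves (specialisation of `hasEntireLFunction_rat_of_wild_of_auxiliaryCurve_of_CDT712_722`).
[cite: BCDTJAMS2001, Theorem 2.2.2] -/
theorem hasEntireLFunction_of_wild_of_auxiliaryCurve_of_CDT712_722
    (hW : exists_isTorsionGaloisRep_and_isModular_of_not_isTamelyRamifiedAbove)
    (hE : exists_isTorsionGaloisRep_five_and_surjective_three) (h712 : CDT_theorem_7_1_2)
    (h722 : CDT_theorem_7_2_2)
    (hOgg : ∀ W : WeierstrassCurve ℚ,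
      W.artinConductorExponent_tate_eq_conductorExponent_of_isElliptic 5)
    (W : WeierstrassCurve ℚ) [W.IsElliptic] : W.HasEntireLFunction :=
  hasEntireLFunction_rat_of_wild_of_auxiliaryCurve_of_CDT712_722 hW hE h712 h722 hOgg W

end WeierstrassCurve
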